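import Summits.QuantumFields.YangMills.Theorems.BalabanUVNodesN08HaarCompatibilityGuardKStepMasses
import Summits.QuantumFields.YangMills.Theorems.BalabanUVNodesN08HaarCompatibilityGuardCoreLawSUN
import Summits.QuantumFields.YangMills.Theorems.BalabanUVNodesN08OneStepExcessDensity
import Literature.MathematicalPhysics.QuantumFieldTheory.Balaban1983to89.T4LimitDensity

/-!
# BalabanUVNodes ∕ N08 — THE k-STEP a.e. BOUND ON PRINT'S ITERATED RADON–NIKODYM HISTORY MASSES AT THE [B10] SLOT FOR EVERY `N` AND EVERY BLOCK SIZE,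
# WITH THE (H_K) HYPOTHESIS DISCHARGED (existential constant); one step divided through; print's own one-step density `T1 ≤ D_j` a.e.

WIDTH SEAT `pub-ymgap-dag-n08-w6` g5, item-3 lineage, 2026-08-28 (INTENT-4).  DAG node N08 = [Balaban1985UV3] Thm 1 p. 257 + Thm 2 p. 272, (41) p. 266 (the history masses),
(5) p. 256 (the extensive shape); the typed (0.4) averaging = [Balaban1987RG1] (0.4) p. 253; key item K1⁷ `StabilityBAtRecordR13SepCoPH` (stmt-QuantumFields-20542),
`--supports … --as helper`.  COUNT-NEUTRAL.

THE POINT.  n08-w3's part 23 (p619156 `…GuardKStepMasses`) bounds print's iterated Radon–Nikodym history masses `massRecAC … (avOfPrint N S) k h` a.e. MODULO the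
per-fibre hypothesis (H_K) at every level `j < k`; n08-w3 g5's part 28 (`…GuardKStepMassesSU2`) discharges (H_K) at `N = 2` on the range `L^{d−1} ≤ 9` with the number
`K⋆ ≤ 3301`.  THIS FILE discharges it for EVERY `N ≥ 1` and EVERY block size with the EXISTENTIAL constant of this seat's `…GuardCoreLawSUN.exists_core_law_le`
(one `K` per level, summed over the finitely many levels `j ≤ m + K̄` into ONE `K`):
 ★★ `exists_fibre_law_le_all_levels` — ONE `K ∈ [1, ∞)` dominating every guard-admitting fibre law at EVERY level `j + 1 ≤ m + K̄` ((H_K) uniformly in the level);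
 ★★★ `exists_massRecAC_avOfPrint_le_prod_ae` — for every `k ≤ m + K̄`, every history `h`, every `δ′ > 0`, all recursion parameters:  `dU_k`-a.e.
    `massRecAC M₁ Rcol εL εS (avOfPrint N S) k h V ≤ Π_{j<k} h(δ′)^{−n_j}·(h(δ′) + (K − 1)·h(δ_N + δ′)^{L^{d−1}−1})^{n_j}` (part 23 `massRecAC_avOfPrint_le_prod_ae_of_pos`);
 ★★ `exists_map_avOfPrint_le_smul` — ONE STEP DIVIDED THROUGH, NO (H_K): `(avOfPrint N S)_{j*}(dU_j) ≤ D_j • dU_{j+1}`, `D_j < ∞` (part 23 `map_avOfPrint_le_smul_of_HK`);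
 ★★ `exists_TOfPrint_one_le_ae` — PRINT'S OWN ONE-STEP DENSITY LETTER `T1 ≤ D_j` `dU_{j+1}`-a.e. (n08-w1's density currency `ρ_j = T1`,
    `…N08OneStepExcessDensity.rnDeriv_map_avOfPrint_ae_eq_TOfPrint_one` + pub-balaban `T4LimitDensity.rnDeriv_le_of_le_smul`), every `N`, every `L`.

HONEST FRAMING.  Bookkeeping by name; the constants are EXISTENTIAL (numbers only at `N = 2`: n08-w3's parts 27C∕28); extensive in the FIRST (finest) coarse lattice — the product
runs over all levels `j < k` with `n_j = #PBond(j+1)` (stacking); this is NOT the k-UNIFORM letter `hmass` (`e^{c|T₁^{(k)}|}`, `c` uniform in `k`) that N08's Theorem-1 letter wants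
(n08-w1's (a)′ ∕ R4⁷–R4⁸ residual); E6′ NOT decided; nothing of Bałaban's asserted; count-neutral; N08 NOT discharged; counts unmoved (typed 28∕28 · discharged 5∕27); one
finite 𝕋⁴ programme at fixed ε — R4 closes the CONDITIONAL rung `BalabanLadder.UV` only; the Yang–Mills mass gap (Clay) is NOT proved; nothing continuum ∕ OS.  0 `sorry`,
0 `def`, standard axioms.
-/

noncomputable section

open MeasureTheory Function
open scoped ENNReal

namespace Summit.QuantumFields.YangMills.BalabanUVNodes.N08HaarCompatibilityGuardKStepMassesSUN

open Literature.MathematicalPhysics.QuantumFieldTheory.Balaban1983to89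
open Summit.QuantumFields.Balaban3D.Carriers
open Summit.QuantumFields.Balaban3D.Proofs.MassesAC
open Literature.MathematicalPhysics.QuantumFieldTheory.Balaban1985CMP102.Setting (Scales)
open Literature.MathematicalPhysics.QuantumFieldTheory.Balaban1983to89.B10RunsOfRecord (avOfPrint TOfPrint)
open Literature.MathematicalPhysics.QuantumFieldTheory.Balaban1983to89.ExpMeanLog (expMeanLogSU measurable_expMeanLogSU_E)
open Literature.MathematicalPhysics.QuantumFieldTheory.Balaban1983to89.BlockAveraging (Small avgFun)
open Literature.MathematicalPhysics.QuantumFieldTheory.Balaban1983to89.BlockAveragingHaarAC (centralBond)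
open Summit.QuantumFields.YangMills.BalabanUVNodes.N08HaarCompatibilityGuardKStepMasses (massRecAC_avOfPrint_le_prod_ae_of_pos map_avOfPrint_le_smul_of_HK
  haar_dist1_lt_ne_zero)
open Summit.QuantumFields.YangMills.BalabanUVNodes.N08HaarCompatibilityGuardFibreCore (fibre_law_le_of_core)
open Summit.QuantumFields.YangMills.BalabanUVNodes.N08HaarCompatibilityGuardCoreLawSUN (exists_core_law_le)
open Summit.QuantumFields.YangMills.BalabanUVNodes.N08OneStepExcessDensity (rnDeriv_map_avOfPrint_ae_eq_TOfPrint_one)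
open Literature.MathematicalPhysics.QuantumFieldTheory.Balaban1983to89.T4LimitDensity (rnDeriv_le_of_le_smul)

variable (N : ℕ) [NeZero N] {L : ℕ} (S : Scales L) (M₁ : ℕ) (Rcol : ℕ → ℕ) (εL εS : ℕ → ℝ)

/-- ★★ **(H_K) UNIFORMLY IN THE LEVEL**: for lattice parameters `P` and the printed `SU(N)` average there is ONE `K ∈ [1, ∞)` such that at EVERY level `j` with `j + 1 ≤ m + K̄`,
every coarse bond and every background, the guard-admitting one-variable fibre law of the typed (0.4) averaging is `≤ K•Haar` (the per-level constants of
`…GuardCoreLawSUN.exists_core_law_le`, summed over the finitely many levels, fed to part 24's `fibre_law_le_of_core`). [cite: Balaban1987RG1, (0.4) p.253 (bookkeeping)] -/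
theorem exists_fibre_law_le_all_levels (P : Params) :
    ∃ K : ℝ≥0∞, 1 ≤ K ∧ K ≠ ∞ ∧ ∀ j, j + 1 ≤ P.m + P.K → ∀ (c : PBond P (j + 1))
      (U : GaugeField P j (Matrix.specialUnitaryGroup (Fin N) ℂ)),
      (∃ g : Matrix.specialUnitaryGroup (Fin N) ℂ,
          Small (expMeanLogSU : LoopAverage (Matrix.specialUnitaryGroup (Fin N) ℂ)) (update U (centralBond c) g) c) →
        (HaarData.haar : Measure (Matrix.specialUnitaryGroup (Fin N) ℂ)).map
            (fun g => avgFun (expMeanLogSU : LoopAverage (Matrix.specialUnitaryGroup (Fin N) ℂ)) (update U (centralBond c) g) c) ≤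
          K • (HaarData.haar : Measure (Matrix.specialUnitaryGroup (Fin N) ℂ)) := by
  classical
  choose K hK1 hKt hK using fun j => exists_core_law_le (N := N) P j
  refine ⟨1 + ∑ j ∈ Finset.range (P.m + P.K), K j, le_add_right le_rfl,
    ENNReal.add_ne_top.2 ⟨ENNReal.one_ne_top, ENNReal.sum_ne_top.2 fun j _ => hKt j⟩, fun j hj c U hU => ?_⟩
  have hle : K j ≤ 1 + ∑ i ∈ Finset.range (P.m + P.K), K i :=
    (Finset.single_le_sum (fun _ _ => zero_le) (Finset.mem_range.2 (by omega) : j ∈ Finset.range (P.m + P.K))).trans le_add_self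
  refine (fibre_law_le_of_core (expMeanLogSU : LoopAverage (Matrix.specialUnitaryGroup (Fin N) ℂ)) hj measurable_expMeanLogSU_E (hK j) c U hU).trans
    (Measure.le_iff'.2 fun A => ?_)
  rw [Measure.smul_apply, Measure.smul_apply, smul_eq_mul, smul_eq_mul]
  exact mul_le_mul' hle le_rfl

/-- ★★★ **THE k-STEP a.e. MASS BOUND AT THE SLOT FOR EVERY `N` AND EVERY BLOCK SIZE, (H_K) DISCHARGED**: there is `K ∈ [1, ∞)` (depending on `N` and the scale datum only)
such that for every `k ≤ m + K̄`, every history `h`, every `δ′ > 0` and all recursion parameters, for `dU_k`-a.e. `V`: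
`massRecAC M₁ Rcol εL εS (avOfPrint N S) k h V ≤ Π_{j<k} h(δ′)^{−n_j}·(h(δ′) + (K − 1)·h(δ_N + δ′)^{L^{d−1}−1})^{n_j}`, `n_j = #PBond(j+1)`, `δ_N = min(1∕3, π∕N)` — part 23's
`massRecAC_avOfPrint_le_prod_ae_of_pos` with its (H_K) hypothesis supplied by `exists_fibre_law_le_all_levels`.  HONEST: fine-lattice-extensive (stacking), NOT `hmass`.
[cite: Balaban1985UV3, (41) p.266 + (5) p.256 + (2) p.256; Balaban1987RG1, (0.4) p.253 (bookkeeping — no bound of print is asserted)] -/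
theorem exists_massRecAC_avOfPrint_le_prod_ae :
    ∃ K : ℝ≥0∞, 1 ≤ K ∧ K ≠ ∞ ∧ ∀ (k : ℕ), k ≤ S.P.m + S.P.K → ∀ {δ' : ℝ}, 0 < δ' → ∀ h : Hist S.P k,
      ∀ᵐ V ∂(fieldMeasure S.P k (Matrix.specialUnitaryGroup (Fin N) ℂ)), massRecAC M₁ Rcol εL εS (avOfPrint N S) k h V ≤
        (∏ j ∈ Finset.range k,
          (((HaarData.haar : Measure (Matrix.specialUnitaryGroup (Fin N) ℂ)) {g : Matrix.specialUnitaryGroup (Fin N) ℂ | dist1 g < δ'} ^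
              Fintype.card (PBond S.P (j + 1)))⁻¹ *
            ((HaarData.haar : Measure (Matrix.specialUnitaryGroup (Fin N) ℂ)) {g : Matrix.specialUnitaryGroup (Fin N) ℂ | dist1 g < δ'} +
                (K - 1) * (HaarData.haar : Measure (Matrix.specialUnitaryGroup (Fin N) ℂ))
                  {g : Matrix.specialUnitaryGroup (Fin N) ℂ | dist1 g < min (1 / 3) (Real.pi / N) + δ'} ^ (S.P.L ^ (S.P.d - 1) - 1)) ^
              Fintype.card (PBond S.P (j + 1)))).toReal := by
  obtain ⟨K, hK1, hKt, hK⟩ := exists_fibre_law_le_all_levels N S.P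
  exact ⟨K, hK1, hKt, fun k hk δ' hδ' h =>
    massRecAC_avOfPrint_le_prod_ae_of_pos N S M₁ Rcol εL εS hK1 hKt k hk (fun j hj c U hU => hK j (by omega) c U hU) hδ' h⟩

/-- ★★ **ONE STEP, DIVIDED THROUGH, NO (H_K), EVERY `N` AND `L`**: at every level `j + 1 ≤ m + K̄` and every `δ′ > 0` there is `D < ∞` with
`(avOfPrint N S)_{j*}(dU_j) ≤ D • dU_{j+1}` — namely part 23's `D_j = h(δ′)^{−n}(h(δ′) + (K − 1)·h(δ_N + δ′)^{L^{d−1}−1})^{n}` at the constant `K` of `exists_fibre_law_le_all_levels`.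
[cite: Balaban1985UV3, (2) p.256; Balaban1987RG1, (0.4) p.253 (bookkeeping — the bound is NOT in print)] -/
theorem exists_map_avOfPrint_le_smul {j : ℕ} (hj : j + 1 ≤ S.P.m + S.P.K) {δ' : ℝ} (hδ' : 0 < δ') :
    ∃ K : ℝ≥0∞, 1 ≤ K ∧ K ≠ ∞ ∧
      (fieldMeasure S.P j (Matrix.specialUnitaryGroup (Fin N) ℂ)).map (avOfPrint N S j).avg ≤
        (((HaarData.haar : Measure (Matrix.specialUnitaryGroup (Fin N) ℂ)) {g : Matrix.specialUnitaryGroup (Fin N) ℂ | dist1 g < δ'} ^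
              Fintype.card (PBond S.P (j + 1)))⁻¹ *
            ((HaarData.haar : Measure (Matrix.specialUnitaryGroup (Fin N) ℂ)) {g : Matrix.specialUnitaryGroup (Fin N) ℂ | dist1 g < δ'} +
                (K - 1) * (HaarData.haar : Measure (Matrix.specialUnitaryGroup (Fin N) ℂ))
                  {g : Matrix.specialUnitaryGroup (Fin N) ℂ | dist1 g < min (1 / 3) (Real.pi / N) + δ'} ^ (S.P.L ^ (S.P.d - 1) - 1)) ^
              Fintype.card (PBond S.P (j + 1))) •
          fieldMeasure S.P (j + 1) (Matrix.specialUnitaryGroup (Fin N) ℂ) := by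
  obtain ⟨K, hK1, hKt, hK⟩ := exists_fibre_law_le_all_levels N S.P
  exact ⟨K, hK1, hKt, map_avOfPrint_le_smul_of_HK N S hj hK1 hKt (hK j hj) (haar_dist1_lt_ne_zero N hδ')⟩

/-- ★★ **PRINT'S OWN ONE-STEP DENSITY LETTER, EVERY `N` AND `L`: `T1 ≤ D_j` a.e.** — the Radon–Nikodym version `TOfPrint` of the one-step transport (n08-w1's density
currency `ρ_j = T1`, `…N08OneStepExcessDensity.rnDeriv_map_avOfPrint_ae_eq_TOfPrint_one`) is `dU_{j+1}`-a.e. bounded by the finite constant of `exists_map_avOfPrint_le_smul`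
(pub-balaban `T4LimitDensity.rnDeriv_le_of_le_smul`), NO (H_K) hypothesis, NO range hypothesis.
[cite: Balaban1985UV3, (2) p.256; Balaban1985Averaging, (10) p.19 (bookkeeping — no bound of print is asserted)] -/
theorem exists_TOfPrint_one_le_ae {j : ℕ} (hj : j + 1 ≤ S.P.m + S.P.K) {δ' : ℝ} (hδ' : 0 < δ') :
    ∃ K : ℝ≥0∞, 1 ≤ K ∧ K ≠ ∞ ∧
      ∀ᵐ V ∂(fieldMeasure S.P (j + 1) (Matrix.specialUnitaryGroup (Fin N) ℂ)), ENNReal.ofReal ((TOfPrint N S j).T 1 V) ≤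
        ((HaarData.haar : Measure (Matrix.specialUnitaryGroup (Fin N) ℂ)) {g : Matrix.specialUnitaryGroup (Fin N) ℂ | dist1 g < δ'} ^
              Fintype.card (PBond S.P (j + 1)))⁻¹ *
          ((HaarData.haar : Measure (Matrix.specialUnitaryGroup (Fin N) ℂ)) {g : Matrix.specialUnitaryGroup (Fin N) ℂ | dist1 g < δ'} +
              (K - 1) * (HaarData.haar : Measure (Matrix.specialUnitaryGroup (Fin N) ℂ))
                {g : Matrix.specialUnitaryGroup (Fin N) ℂ | dist1 g < min (1 / 3) (Real.pi / N) + δ'} ^ (S.P.L ^ (S.P.d - 1) - 1)) ^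
            Fintype.card (PBond S.P (j + 1)) := by
  haveI := HaarData.isProb (G := Matrix.specialUnitaryGroup (Fin N) ℂ)
  obtain ⟨K, hK1, hKt, hK⟩ := exists_map_avOfPrint_le_smul N S hj hδ'
  refine ⟨K, hK1, hKt, ?_⟩
  filter_upwards [rnDeriv_le_of_le_smul hK, rnDeriv_map_avOfPrint_ae_eq_TOfPrint_one N S j] with V hV hT
  rw [← hT]; exact hV

end Summit.QuantumFields.YangMills.BalabanUVNodes.N08HaarCompatibilityGuardKStepMassesSUN

end
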